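import Literature.NumberTheory.GelbartRogawski1991.UnitaryDualPairThetaKernelCM
import HarnessLib

/-!
# [GelbartRogawski1991, Prop. 3.1.1] at the CM dual-pair data: the degenerate sizes split trivially,
# and the uniform hypothesis reduces to the printed scope `dim V ≥ 1`

Topic `NumberTheory/GelbartRogawski1991`; namespace `Literature.NumberTheory.GelbartRogawski1991`.
Kernel companion of `CompatibleSplitting.lean` ∕ `UnitaryDualPairThetaKernelCM.lean`, written for the
citation-fit ledger of the Hodge-CM acceptance package (row CF06): the stage-1 E term displays the ONE
cited input `hGRU` = the named fact `SplittingDatum.CompatibleSplitting` ([GelbartRogawski1991,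
Prop. 3.1.1, p. 455 L1–3]) at EVERY constructed CM dual-pair datum `cmSplittingDatum L e dV … dW …`,
as a closed Π-type over ALL sizes `N`, `M` (`e : Fin N × Fin M ≃ Fin n`, so `n = N·M`), whereas the
printed proposition speaks of "a skew Hermitian space, where `V` is an `n`-dimensional vector space over
`E`" (p. 454 L43–44; proof for "a skew Hermitian form `Φ_n` in `n` variables", p. 456 L27–28), i.e. of
`n ≥ 1`.  The two theorems below close the gap in the kernel:

* `SplittingDatum.compatibleSplitting_of_subsingleton` — over a trivial group `G(𝐀)` every splitting
  datum splits compatibly (`s = 1`); hence `cmSplittingDatum_compatibleSplitting_of_isEmpty` ∕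
  `…_of_eq_zero`: the data with `Fin N × Fin M` empty (`N = 0` or `M = 0`, i.e. `n = 0`,
  `G₁(𝔸) = U(diag dV ⊗ diag dW)(𝔸) ≤ GL_{Fin N × Fin M}(𝔸_L)` trivial) satisfy the record outright;
* `compatibleSplitting_cm_of_pos` — the uniform hypothesis over all sizes FOLLOWS from its restriction
  to `0 < n` (the printed scope), uniformly in the CM field `L` and the diagonal data.

So the displayed input `hGRU` is implied by [GelbartRogawski1991, Prop. 3.1.1] read at the big unitary
groups `G₁ = U(δ·(diag dV ⊗ diag dW))`, `dim = N·M ≥ 1`, over `L ∕ L⁺` (object match: module docstring of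
`CompatibleSplitting.lean`, (a)–(e)); nothing of the proposition is asserted or proved here.
Kernel only: 0 records, 0 `sorry`; every theorem is our own proof of (an instance, or a reduction between
instances, of) the cited statement.
-/

namespace Literature.NumberTheory.GelbartRogawski1991

namespace SplittingDatum

universe u v w

variable {Sp : Type u} {Mp : Type v} {GA : Type w} [Group Sp] [Group Mp] [Group GA]

/-- **Over a trivial `G(𝐀)` every splitting datum splits compatibly**: `s = 1` is a continuous
homomorphic section of `π` over `ι` (both sides are `1`) carrying `G(F) = {1}` into `i(Sp_F(W)) ∋ 1` —
our proof of the cited proposition in the degenerate case `G(𝐀) = 1`.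
[cite: GelbartRogawski1991, §3.1 Prop. 3.1.1 p. 455 L1–3] -/
theorem compatibleSplitting_of_subsingleton [TopologicalSpace GA] [TopologicalSpace Mp]
    [Subsingleton GA] (D : SplittingDatum Sp Mp GA) : D.CompatibleSplitting := by
  refine ⟨1, continuous_const, fun g => ?_, fun γ _ => ?_⟩
  · rw [Subsingleton.elim g 1, MonoidHom.one_apply, map_one, map_one]
  · rw [Subsingleton.elim γ 1, MonoidHom.one_apply]
    exact one_mem _

end SplittingDatum

namespace UnitaryDualPair

open NumberField

section CMDegenerate

variable (L : Type) [Field L] [NumberField L] [IsCMField L] {N M n : ℕ} (e : Fin N × Fin M ≃ Fin n)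
variable (dV : Fin N → L) (hdV : ∀ i, IsCMField.complexConj L (dV i) = dV i) (hdV0 : ∀ i, dV i ≠ 0)
variable (dW : Fin M → L) (hdW : ∀ i, IsCMField.complexConj L (dW i) = dW i) (hdW0 : ∀ i, dW i ≠ 0)

/-- **degenerate CM dual pairs split trivially**: if `Fin N × Fin M` is empty (`N = 0` or `M = 0`), the
big unitary group `G₁(𝔸) ≤ GL_{Fin N × Fin M}(𝔸_L)` of `cmSplittingDatum` is trivial, so the record
`CompatibleSplitting` holds at that datum with `s = 1` — our proof of the cited proposition at these data,
no appeal to its printed proof. [cite: GelbartRogawski1991, §3.1 Prop. 3.1.1 p. 455 L1–3] -/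
theorem cmSplittingDatum_compatibleSplitting_of_isEmpty [IsEmpty (Fin N × Fin M)] :
    (cmSplittingDatum L e dV hdV hdV0 dW hdW hdW0).CompatibleSplitting :=
  SplittingDatum.compatibleSplitting_of_subsingleton _

/-- the same, hypothesis `n = 0` (`e : Fin N × Fin M ≃ Fin n` forces `Fin N × Fin M` empty).
[cite: GelbartRogawski1991, §3.1 Prop. 3.1.1 p. 455 L1–3] -/
theorem cmSplittingDatum_compatibleSplitting_of_eq_zero (hn : n = 0) :
    (cmSplittingDatum L e dV hdV hdV0 dW hdW hdW0).CompatibleSplitting := by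
  haveI : IsEmpty (Fin N × Fin M) :=
    Fintype.card_eq_zero_iff.mp (by rw [Fintype.card_congr e, Fintype.card_fin, hn])
  exact cmSplittingDatum_compatibleSplitting_of_isEmpty L e dV hdV hdV0 dW hdW hdW0

/-- the same, hypothesis `N = 0` (no `V`-directions). [cite: GelbartRogawski1991, §3.1 Prop. 3.1.1 p. 455 L1–3] -/
theorem cmSplittingDatum_compatibleSplitting_of_left_eq_zero (hN : N = 0) :
    (cmSplittingDatum L e dV hdV hdV0 dW hdW hdW0).CompatibleSplitting := by
  subst hN
  exact cmSplittingDatum_compatibleSplitting_of_isEmpty L e dV hdV hdV0 dW hdW hdW0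

/-- the same, hypothesis `M = 0` (no `W`-directions). [cite: GelbartRogawski1991, §3.1 Prop. 3.1.1 p. 455 L1–3] -/
theorem cmSplittingDatum_compatibleSplitting_of_right_eq_zero (hM : M = 0) :
    (cmSplittingDatum L e dV hdV hdV0 dW hdW hdW0).CompatibleSplitting := by
  subst hM
  exact cmSplittingDatum_compatibleSplitting_of_isEmpty L e dV hdV hdV0 dW hdW hdW0

/-- pointwise print-scope reduction at ONE datum: the record at `cmSplittingDatum L e dV … dW …` follows
from its restriction to `0 < n` (`n = dim_L (V ⊗ W)`). [cite: GelbartRogawski1991, §3.1 p. 454 L43–48, Prop. 3.1.1 p. 455 L1–3] -/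
theorem cmSplittingDatum_compatibleSplitting_of_pos
    (h : 0 < n → (cmSplittingDatum L e dV hdV hdV0 dW hdW hdW0).CompatibleSplitting) :
    (cmSplittingDatum L e dV hdV hdV0 dW hdW hdW0).CompatibleSplitting :=
  (Nat.eq_zero_or_pos n).elim
    (fun hn => cmSplittingDatum_compatibleSplitting_of_eq_zero L e dV hdV hdV0 dW hdW hdW0 hn) h

end CMDegenerate

/-- **Print-scope reduction of the uniform [GelbartRogawski1991, Prop. 3.1.1] hypothesis.**  The closed
Π-type "`CompatibleSplitting` at every CM dual-pair datum `cmSplittingDatum L e dV … dW …`" (all CM number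
fields `L`, all sizes `N`, `M`, `n = N·M`, all real non-zero diagonal data) — the shape in which the
proposition is displayed as a cited input by its consumers — follows from its restriction to `0 < n`,
i.e. to non-zero skew-Hermitian spaces `V ⊗ W` ("`V` is an `n`-dimensional vector space over `E`",
p. 454 L43–44), the size-`0` data being `cmSplittingDatum_compatibleSplitting_of_eq_zero`.
[cite: GelbartRogawski1991, §3.1 p. 454 L43–48, Prop. 3.1.1 p. 455 L1–3] -/
theorem compatibleSplitting_cm_of_pos
    (h : ∀ (L : Type) [Field L] [NumberField L] [IsCMField L] {N M n : ℕ} (e : Fin N × Fin M ≃ Fin n)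
      (dV : Fin N → L) (hdV : ∀ i, IsCMField.complexConj L (dV i) = dV i) (hdV0 : ∀ i, dV i ≠ 0)
      (dW : Fin M → L) (hdW : ∀ i, IsCMField.complexConj L (dW i) = dW i) (hdW0 : ∀ i, dW i ≠ 0),
      0 < n → (cmSplittingDatum L e dV hdV hdV0 dW hdW hdW0).CompatibleSplitting)
    (L : Type) [Field L] [NumberField L] [IsCMField L] {N M n : ℕ} (e : Fin N × Fin M ≃ Fin n)
    (dV : Fin N → L) (hdV : ∀ i, IsCMField.complexConj L (dV i) = dV i) (hdV0 : ∀ i, dV i ≠ 0)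
    (dW : Fin M → L) (hdW : ∀ i, IsCMField.complexConj L (dW i) = dW i) (hdW0 : ∀ i, dW i ≠ 0) :
    (cmSplittingDatum L e dV hdV hdV0 dW hdW hdW0).CompatibleSplitting :=
  -- term mode on purpose: `rcases` here costs ≈ 3·10⁵ heartbeats (context re-elaboration), `Or.elim` ≈ 2·10³
  (Nat.eq_zero_or_pos n).elim
    (fun hn => cmSplittingDatum_compatibleSplitting_of_eq_zero L e dV hdV hdV0 dW hdW hdW0 hn)
    fun hn => h L e dV hdV hdV0 dW hdW hdW0 hn

/-- the same reduction with the printed scope read on the two factors: `0 < N` and `0 < M`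
(`n = N·M`). [cite: GelbartRogawski1991, §3.1 p. 454 L43–48, Prop. 3.1.1 p. 455 L1–3] -/
theorem compatibleSplitting_cm_of_pos_pos
    (h : ∀ (L : Type) [Field L] [NumberField L] [IsCMField L] {N M n : ℕ} (e : Fin N × Fin M ≃ Fin n)
      (dV : Fin N → L) (hdV : ∀ i, IsCMField.complexConj L (dV i) = dV i) (hdV0 : ∀ i, dV i ≠ 0)
      (dW : Fin M → L) (hdW : ∀ i, IsCMField.complexConj L (dW i) = dW i) (hdW0 : ∀ i, dW i ≠ 0),
      0 < N → 0 < M → (cmSplittingDatum L e dV hdV hdV0 dW hdW hdW0).CompatibleSplitting)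
    (L : Type) [Field L] [NumberField L] [IsCMField L] {N M n : ℕ} (e : Fin N × Fin M ≃ Fin n)
    (dV : Fin N → L) (hdV : ∀ i, IsCMField.complexConj L (dV i) = dV i) (hdV0 : ∀ i, dV i ≠ 0)
    (dW : Fin M → L) (hdW : ∀ i, IsCMField.complexConj L (dW i) = dW i) (hdW0 : ∀ i, dW i ≠ 0) :
    (cmSplittingDatum L e dV hdV hdV0 dW hdW hdW0).CompatibleSplitting :=
  (Nat.eq_zero_or_pos N).elim
    (fun hN => cmSplittingDatum_compatibleSplitting_of_left_eq_zero L e dV hdV hdV0 dW hdW hdW0 hN)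
    fun hN => (Nat.eq_zero_or_pos M).elim
      (fun hM => cmSplittingDatum_compatibleSplitting_of_right_eq_zero L e dV hdV hdV0 dW hdW hdW0 hM)
      fun hM => h L e dV hdV hdV0 dW hdW hdW0 hN hM

end UnitaryDualPair

end Literature.NumberTheory.GelbartRogawski1991
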